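import Summits.KontsevichZagierPeriods.KontsevichZagierPeriods.Theses.RealPeriodGerms

/-!
# `Assembly` (stmt-KontsevichZagierPeriods-3848, route RealPeriodGerms) — proof

The route's assembly item `GermComplete → RealTransfer → KontsevichZagierPeriods` is the body of
its deciding theorem `closes` read as an implication: `closes` carries the five further route items
as (unused) binders, so its argument is replayed here on the two hypotheses it consumes.
(lead c10 of crux 9129, banking)
-/

namespace Summit.KontsevichZagierPeriods.RealPeriodGerms

/-- **Assembly of route RealPeriodGerms** (stmt-KontsevichZagierPeriods-3848):
`GermComplete → RealTransfer → KontsevichZagierPeriods`. For rational-shape representations `r, r'`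
with equal values, `GermComplete` at the parameter-free point (`N = 0`, `p = Fin.elim0`, where
`Fin.append x p = x` and the germ hypothesis is just `r.value = r'.value`) puts
`gen r - gen r'` in the real relation module, and `RealTransfer` descends this to
`KZ.of r - KZ.of r' ∈ KZ.relations` — verbatim the argument of the route's deciding theorem
`closes`, which states it behind five more (unused) route-item binders.
[Kontsevich–Zagier 2001, §1.2] [folklore] -/
theorem assembly_proof :
    Summit.KontsevichZagierPeriods.KontsevichZagierPeriods.Theses.RealPeriodGerms.Assembly := by
  intro hC hT n m r r' _ _ hval
  -- bookkeeping at N = 0: appending an empty block of coordinates is the identity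
  have happ : ∀ (k : ℕ) (x : Fin k → ℝ) (z : Fin 0 → ℝ), Fin.append x z = x :=
    fun k x z => funext fun i => Fin.append_left x z i
  refine hT n m r r' ?_
  have key := hC 0 n m Fin.elim0 r.domain r.integrand r'.domain r'.integrand
    r.isSemialgebraic_domain r.isSemialgebraicFunOn_integrand r'.isSemialgebraic_domain
    r'.isSemialgebraicFunOn_integrand
    ⟨Set.univ, Filter.univ_mem, fun z _ _ => by
      simp only [happ, Set.setOf_mem_eq]
      exact ⟨r.integrableOn, r'.integrableOn, hval⟩⟩
  simp only [happ, Set.setOf_mem_eq] at key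
  exact key

end Summit.KontsevichZagierPeriods.RealPeriodGerms
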